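import Mathlib
import Summits.NavierStokesRegularity.NavierStokesRegularity.Theorems.EulerZoomLiouvillePowerGaugeEulerLiouvilleSelfSimilarPressureCapacity
import HarnessLib

/-!
# THE PRESSURISED SET IS TWO-DIMENSIONALLY SMALL — the Frostman (section) form of the capacity bound
# (crux `EulerZoomLiouville.PowerGaugeEulerLiouville` = stmt-NavierStokesRegularity-19832, THE ONE STATEMENT, T2 face «pressurised stagnant tubes / capacity margin»;
#  line `needle_faces` stubs B / B♯; width seat ns-ezl-w1 g5)

Route №10 `EulerZoomLiouville` (NavierStokesRegularity).  Sequel of `…SelfSimilarPressureCapacity` (`measure_pressurised_le_of_potential_le`: every finite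
measure with Newtonian potential `≤ Θ` charges the `κL²`-excess set `S` of the pressure by `≤ (12/m)Θ c_E(3L)^{1−ρ}/(κL²)`).  Here the potential bound is
supplied for 2-DIMENSIONAL measures:

* **`lintegral_inv_norm_sub_le_of_frostman`** — a finite Borel measure on `ℝ³` with the 2-Frostman growth `ν(B(z, r)) ≤ A r²` (all `z`, `r > 0`) and total
  mass `M` has Newtonian potential `∫ ‖x − z‖⁻¹ dν(x) ≤ 2√(A M)` at every point (layer cake `∫₀^∞ ν(B(z, 1/t)) dt ≤ ∫₀^∞ min(M, A t⁻²) dt`, split at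
  `t₀ = √(A/M)`);
* **`measure_pressurised_le_of_frostman`** — for a `C²` self-similar Euler profile with the class `E`-gauge, `L ≥ 1`, `0 < R ≤ L`, `κ > 0`, a measurable set
  `S ⊆ B̄_L(0)` of `κL²`-excess points, and any finite 2-Frostman measure `ν`:  `ν(S) ≤ 4A · ((12/m) c_E (3L)^{1−ρ}/(κL²))²`
  (apply the dual bound to `ν|_S`, whose mass is `ν(S)` and potential `≤ 2√(A ν(S))`, and square);
* **`measure_pressurised_le_of_frostman_rpow`** — the rate form `ν(S) ≤ 4A (12·3^{1−ρ} c_E/(m κ))² · L^{−2−2ρ}`.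

READING.  Instances of 2-Frostman measures: area measure on a PLANE (`A = π`) or on any SPHERE, surface measure on a rectifiable surface of bounded density,
and Lebesgue measure on a SLAB of thickness `2δ` divided by `2δ` (`A ≤ π`).  So EVERY planar or spherical SECTION of the pressurised set of the shell `L` has
area `≲ (c_E/κ)² L^{−2−2ρ}` — the angular size of the pressurised patch on every sphere `|x| = R ∈ [L, 2L]` is `≲ (c_E/κ)² L^{−4−2ρ}` — and every slab meets
it in volume `≲ δ (c_E/κ)² L^{−2−2ρ}`.  Volume thinness (`≲ L^{−3−3ρ}`, any of the three proofs) bounds only the AVERAGE section over a shell; this bounds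
EVERY section.  What it still cannot see: a radial segment (1-dimensional measures are not Frostman-2; capacity 0) — see the honest reading in
`…SelfSimilarPressureCapacity` and the consistency check in HOME/ns-ezl-w1/HANDOFF-g5.md.

HONEST LABEL: tool + portrait stratum; nothing here excludes a needle.  WHAT THIS IS NOT: not NS, not E — `--supports` stmt-19832 on the MODEL lattice;
19832 OPEN; NS regularity NOT proved. [folklore; Landkof 1972 Ch. II §1, Ch. III §4 (Frostman); GilbargTrudinger2001 Thm 2.1]
-/

noncomputable section

-- flat `Theorems/<Route><Decl>…` files of one crux share the namespace of the crux (tree convention)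
set_option linter.dupNamespace false

open MeasureTheory Set Filter Topology Metric Function InnerProductSpace
open scoped RealInnerProductSpace NNReal ENNReal

namespace Summit.NavierStokesRegularity.NavierStokesRegularity.Theorems.PowerGaugeEulerLiouville.PressureParking

open Literature.Analysis Literature.Analysis.FluidPDE

/-! ### The potential of a 2-Frostman measure -/

/-- `∫_{(t₀, ∞)} t⁻² dt = t₀⁻¹` as a `∫⁻` (`t₀ > 0`). [folklore] -/
theorem lintegral_Ioi_inv_sq {t₀ : ℝ} (ht₀ : 0 < t₀) :
    ∫⁻ t in Ioi t₀, ENNReal.ofReal (t ^ 2)⁻¹ = ENNReal.ofReal t₀⁻¹ := by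
  have hint : IntegrableOn (fun t : ℝ => t ^ (-2 : ℝ)) (Ioi t₀) := integrableOn_Ioi_rpow_of_lt (by norm_num) ht₀
  have heq : EqOn (fun t : ℝ => (t ^ 2)⁻¹) (fun t : ℝ => t ^ (-2 : ℝ)) (Ioi t₀) := fun t ht => by
    have ht0 : 0 < t := ht₀.trans ht
    show (t ^ 2)⁻¹ = t ^ (-2 : ℝ)
    rw [Real.rpow_neg ht0.le, Real.rpow_two]
  have hint' : IntegrableOn (fun t : ℝ => (t ^ 2)⁻¹) (Ioi t₀) := hint.congr_fun heq.symm measurableSet_Ioi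
  rw [← ofReal_integral_eq_lintegral_ofReal hint' (Eventually.of_forall fun t => by positivity),
    setIntegral_congr_fun measurableSet_Ioi heq, integral_Ioi_rpow_of_lt (by norm_num) ht₀]
  congr 1
  rw [show (-2 : ℝ) + 1 = -1 by norm_num, Real.rpow_neg_one]
  ring

/-- **THE NEWTONIAN POTENTIAL OF A 2-FROSTMAN MEASURE IS BOUNDED.**  If a finite Borel measure `ν` on `ℝ³` satisfies `ν(B(z, r)) ≤ A r²` for every centre
`z` and radius `r > 0` (`A > 0`), then for every `z`:  `∫ ‖x − z‖⁻¹ dν(x) ≤ 2 √(A · ν(ℝ³))`  (layer cake: `ν{‖x − z‖⁻¹ > t} ≤ min(ν(ℝ³), A t⁻²)`, split at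
`t₀ = √(A/ν(ℝ³))`). [folklore; Landkof 1972 Ch. III §4] -/
theorem lintegral_inv_norm_sub_le_of_frostman (ν : Measure (EuclideanSpace ℝ (Fin 3))) [IsFiniteMeasure ν] {A : ℝ} (hA : 0 < A)
    (hν : ∀ (z : EuclideanSpace ℝ (Fin 3)) (r : ℝ), 0 < r → ν (ball z r) ≤ ENNReal.ofReal (A * r ^ 2))
    (z : EuclideanSpace ℝ (Fin 3)) :
    ∫⁻ x, ENNReal.ofReal ‖x - z‖⁻¹ ∂ν ≤ ENNReal.ofReal (2 * Real.sqrt (A * (ν univ).toReal)) := by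
  set M : ℝ := (ν univ).toReal with hMdef
  have hM0 : 0 ≤ M := ENNReal.toReal_nonneg
  -- layer cake
  have hmeas : AEMeasurable (fun x : EuclideanSpace ℝ (Fin 3) => ‖x - z‖⁻¹) ν :=
    (measurable_id.sub measurable_const).norm.inv.aemeasurable
  rw [lintegral_eq_lintegral_meas_lt ν (Eventually.of_forall fun x => inv_nonneg.2 (norm_nonneg _)) hmeas]
  -- the superlevel sets are inside balls
  have hsub : ∀ t : ℝ, 0 < t → {x : EuclideanSpace ℝ (Fin 3) | t < ‖x - z‖⁻¹} ⊆ ball z t⁻¹ := by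
    intro t ht x hx
    rw [mem_ball, dist_eq_norm]
    have hx' : t < ‖x - z‖⁻¹ := hx
    have hpos : 0 < ‖x - z‖ := by
      by_contra h0
      have : ‖x - z‖ = 0 := le_antisymm (not_lt.1 h0) (norm_nonneg _)
      rw [this, inv_zero] at hx'
      exact absurd hx' (not_lt.2 ht.le)
    calc ‖x - z‖ = (‖x - z‖⁻¹)⁻¹ := (inv_inv _).symm
      _ < t⁻¹ := (inv_lt_inv₀ (inv_pos.2 hpos) ht).2 hx'
  by_cases hMz : M = 0
  · -- `ν = 0`-mass: everything vanishes
    have hν0 : ν univ = 0 := by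
      have := (ENNReal.toReal_eq_zero_iff _).1 (hMdef ▸ hMz)
      exact this.resolve_right (measure_ne_top ν _)
    have : ∀ t, ν {x : EuclideanSpace ℝ (Fin 3) | t < ‖x - z‖⁻¹} = 0 := fun t => measure_mono_null (subset_univ _) hν0
    simp only [this, lintegral_zero, zero_le]
  have hMpos : 0 < M := lt_of_le_of_ne hM0 (Ne.symm hMz)
  set t₀ : ℝ := Real.sqrt (A / M) with ht₀def
  have ht₀ : 0 < t₀ := Real.sqrt_pos.2 (div_pos hA hMpos)
  have ht₀sq : t₀ ^ 2 = A / M := Real.sq_sqrt (div_pos hA hMpos).le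
  -- split `(0, ∞) = (0, t₀] ∪ (t₀, ∞)`
  have hsplit : Ioi (0 : ℝ) = Ioc 0 t₀ ∪ Ioi t₀ := (Ioc_union_Ioi_eq_Ioi ht₀.le).symm
  rw [hsplit]
  refine (lintegral_union_le _ _ _).trans ?_
  -- near part: `≤ M t₀`
  have hnear : (∫⁻ t in Ioc (0 : ℝ) t₀, ν {x : EuclideanSpace ℝ (Fin 3) | t < ‖x - z‖⁻¹}) ≤ ENNReal.ofReal (M * t₀) := by
    calc (∫⁻ t in Ioc (0 : ℝ) t₀, ν {x : EuclideanSpace ℝ (Fin 3) | t < ‖x - z‖⁻¹})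
        ≤ ∫⁻ t in Ioc (0 : ℝ) t₀, ν univ := lintegral_mono fun t => measure_mono (subset_univ _)
      _ = ν univ * volume (Ioc (0 : ℝ) t₀) := setLIntegral_const _ _
      _ = ENNReal.ofReal (M * t₀) := by
          rw [Real.volume_Ioc, sub_zero, hMdef, ENNReal.ofReal_mul hM0, ENNReal.ofReal_toReal (measure_ne_top ν _)]
  -- far part: `≤ A / t₀`
  have hfar : (∫⁻ t in Ioi t₀, ν {x : EuclideanSpace ℝ (Fin 3) | t < ‖x - z‖⁻¹}) ≤ ENNReal.ofReal (A * t₀⁻¹) := by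
    calc (∫⁻ t in Ioi t₀, ν {x : EuclideanSpace ℝ (Fin 3) | t < ‖x - z‖⁻¹})
        ≤ ∫⁻ t in Ioi t₀, ENNReal.ofReal A * ENNReal.ofReal (t ^ 2)⁻¹ := by
          refine setLIntegral_mono' measurableSet_Ioi fun t ht => ?_
          have ht' : 0 < t := ht₀.trans ht
          calc ν {x : EuclideanSpace ℝ (Fin 3) | t < ‖x - z‖⁻¹} ≤ ν (ball z t⁻¹) := measure_mono (hsub t ht')
            _ ≤ ENNReal.ofReal (A * t⁻¹ ^ 2) := hν z t⁻¹ (inv_pos.2 ht')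
            _ = ENNReal.ofReal A * ENNReal.ofReal (t ^ 2)⁻¹ := by rw [← ENNReal.ofReal_mul hA.le, inv_pow]
      _ = ENNReal.ofReal A * ∫⁻ t in Ioi t₀, ENNReal.ofReal (t ^ 2)⁻¹ := lintegral_const_mul' _ _ ENNReal.ofReal_ne_top
      _ = ENNReal.ofReal (A * t₀⁻¹) := by rw [lintegral_Ioi_inv_sq ht₀, ← ENNReal.ofReal_mul hA.le]
  refine (add_le_add hnear hfar).trans ?_
  rw [← ENNReal.ofReal_add (by positivity) (by positivity)]
  refine ENNReal.ofReal_le_ofReal (le_of_eq ?_)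
  -- `M t₀ + A/t₀ = 2 √(A M)`
  have hAM : Real.sqrt (A * M) = M * t₀ := by
    rw [ht₀def, Real.sqrt_eq_iff_mul_self_eq_of_pos (by positivity)]
    · have : M * Real.sqrt (A / M) * (M * Real.sqrt (A / M)) = M ^ 2 * (Real.sqrt (A / M)) ^ 2 := by ring
      rw [this, Real.sq_sqrt (div_pos hA hMpos).le]
      field_simp
  have h2 : A * t₀⁻¹ = M * t₀ := by
    have ht₀ne : t₀ ≠ 0 := ht₀.ne'
    field_simp
    nlinarith [ht₀sq, mul_comm M (t₀ ^ 2), (div_mul_cancel₀ A hMpos.ne' : A / M * M = A)]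
  rw [h2, hAM]; ring

/-! ### The Frostman form of the dual-capacity bound -/

variable {ρ γ : ℝ} {c : EuclideanSpace ℝ (Fin 3)}
  {V : EuclideanSpace ℝ (Fin 3) → EuclideanSpace ℝ (Fin 3)} {P' : EuclideanSpace ℝ (Fin 3) → ℝ}

/-- **THE PRESSURISED SET IS TWO-DIMENSIONALLY SMALL.**  Let `(V, P′)` be a `C²` self-similar Euler profile on `ℝ³` (any `γ`, any centre) with the class
`E`-gauge growth `∫_{B_L(0)}‖DV‖² ≤ c_E L^{1−ρ}`; `L ≥ 1`, `0 < R ≤ L`, `κ > 0`; `S ⊆ B̄_L(0)` a measurable set of points whose pressure exceeds its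
`χ_R`-average by `κL²`; `ν` a finite Borel measure with the 2-Frostman growth `ν(B(z,r)) ≤ A r²` (`A > 0`).  Then
`ν(S) ≤ 4A · ((12/m) c_E (3L)^{1−ρ} / (κ L²))²`  — every planar / spherical section of the pressurised set of the shell has area `≲ (c_E/κ)² L^{−2−2ρ}`.
[folklore; Landkof 1972 Ch. II §1, Ch. III §4] -/
theorem measure_pressurised_le_of_frostman (hprof : IsSelfSimilarEulerProfile γ c V P') {cE : ℝ} (hcE : 0 ≤ cE)
    (hE : ∀ L : ℝ, 0 < L → ∫⁻ y in ball (0 : EuclideanSpace ℝ (Fin 3)) L, ‖fderiv ℝ V y‖ₑ ^ 2 ≤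
      ENNReal.ofReal (cE * L ^ (1 - ρ)))
    {L R κ : ℝ} (hL : 1 ≤ L) (hR : 0 < R) (hRL : R ≤ L) (hκ : 0 < κ)
    {S : Set (EuclideanSpace ℝ (Fin 3))} (hSm : MeasurableSet S)
    (hS : ∀ x₀ ∈ S, ‖x₀‖ ≤ L ∧ κ * L ^ 2 + ∫ y, probeBump R y * P' (x₀ + y) ≤ P' x₀)
    (ν : Measure (EuclideanSpace ℝ (Fin 3))) [IsFiniteMeasure ν] {A : ℝ} (hA : 0 < A)
    (hν : ∀ (z : EuclideanSpace ℝ (Fin 3)) (r : ℝ), 0 < r → ν (ball z r) ≤ ENNReal.ofReal (A * r ^ 2)) :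
    (ν S).toReal ≤ 4 * A * (12 / baseBumpMass (EuclideanSpace ℝ (Fin 3)) * (cE * (3 * L) ^ (1 - ρ)) / (κ * L ^ 2)) ^ 2 := by
  set m : ℝ := baseBumpMass (EuclideanSpace ℝ (Fin 3)) with hmdef
  have hm : 0 < m := baseBumpMass_pos
  have hL0 : 0 < L := one_pos.trans_le hL
  set M : ℝ := (ν S).toReal with hMdef
  have hM0 : 0 ≤ M := ENNReal.toReal_nonneg
  set A₀ : ℝ := 12 / m * (cE * (3 * L) ^ (1 - ρ)) with hA₀
  have hA₀0 : 0 ≤ A₀ := by positivity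
  set t : ℝ := κ * L ^ 2 with ht
  have ht0 : 0 < t := by positivity
  -- the restricted measure `ν|_S`: mass `M`, still 2-Frostman
  haveI : IsFiniteMeasure (ν.restrict S) := inferInstance
  have hνS : ∀ (z : EuclideanSpace ℝ (Fin 3)) (r : ℝ), 0 < r → (ν.restrict S) (ball z r) ≤ ENNReal.ofReal (A * r ^ 2) :=
    fun z r hr => (Measure.restrict_apply_le _ _).trans (hν z r hr)
  have hmass : ((ν.restrict S) univ).toReal = M := by rw [Measure.restrict_apply_univ]
  set Θ : ℝ := 2 * Real.sqrt (A * M) with hΘ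
  have hΘ0 : 0 ≤ Θ := by positivity
  have hpot : ∀ z : EuclideanSpace ℝ (Fin 3), ∫⁻ x, ENNReal.ofReal ‖x - z‖⁻¹ ∂(ν.restrict S) ≤ ENNReal.ofReal Θ := fun z => by
    have h := lintegral_inv_norm_sub_le_of_frostman (ν.restrict S) hA hνS z
    rwa [hmass] at h
  have hcap := measure_pressurised_le_of_potential_le hprof hcE hE hL hR hRL hκ hΘ0 (ν.restrict S) hSm hS hpot
  rw [Measure.restrict_apply hSm, inter_self] at hcap
  -- `t M ≤ A₀ · 2√(A M)` ⇒ `M ≤ 4 A (A₀/t)²`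
  have h1 : t * M ≤ A₀ * (2 * Real.sqrt (A * M)) := by
    have e : 12 / m * Θ * (cE * (3 * L) ^ (1 - ρ)) = A₀ * (2 * Real.sqrt (A * M)) := by rw [hΘ, hA₀]; ring
    linarith [hcap, e]
  have hsq : Real.sqrt (A * M) ^ 2 = A * M := Real.sq_sqrt (by positivity)
  have hs0 : 0 ≤ Real.sqrt (A * M) := Real.sqrt_nonneg _
  -- `(t √M')² = t² M ≤ …`: square the inequality `t M ≤ 2A₀√(AM)`
  have h2 : (t * M) ^ 2 ≤ (A₀ * (2 * Real.sqrt (A * M))) ^ 2 := pow_le_pow_left₀ (by positivity) h1 2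
  have h3 : (A₀ * (2 * Real.sqrt (A * M))) ^ 2 = 4 * A * M * A₀ ^ 2 := by
    rw [show (A₀ * (2 * Real.sqrt (A * M))) ^ 2 = A₀ ^ 2 * 4 * Real.sqrt (A * M) ^ 2 by ring, hsq]; ring
  rw [h3] at h2
  -- `t² M² ≤ 4 A M A₀²` ⇒ `M ≤ 4 A A₀² / t²`
  have h4 : M * (t ^ 2 * M) ≤ M * (4 * A * A₀ ^ 2) := by nlinarith
  by_cases hMz : M = 0
  · rw [hMz]; positivity
  · have hMpos : 0 < M := lt_of_le_of_ne hM0 (Ne.symm hMz)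
    have h5 : t ^ 2 * M ≤ 4 * A * A₀ ^ 2 := le_of_mul_le_mul_left h4 hMpos
    rw [div_pow]
    rw [show 4 * A * (A₀ ^ 2 / t ^ 2) = 4 * A * A₀ ^ 2 / t ^ 2 by ring, le_div_iff₀ (by positivity)]
    linarith

/-- **Rate form.**  Under the same hypotheses: `ν(S) ≤ 4A (12·3^{1−ρ} c_E/(m κ))² · L^{−2−2ρ}` — for every 2-Frostman measure (planar and spherical sections,
rectifiable surfaces of bounded density, slabs per unit thickness). [folklore] -/
theorem measure_pressurised_le_of_frostman_rpow (hprof : IsSelfSimilarEulerProfile γ c V P') {cE : ℝ} (hcE : 0 ≤ cE)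
    (hE : ∀ L : ℝ, 0 < L → ∫⁻ y in ball (0 : EuclideanSpace ℝ (Fin 3)) L, ‖fderiv ℝ V y‖ₑ ^ 2 ≤
      ENNReal.ofReal (cE * L ^ (1 - ρ)))
    {L R κ : ℝ} (hL : 1 ≤ L) (hR : 0 < R) (hRL : R ≤ L) (hκ : 0 < κ)
    {S : Set (EuclideanSpace ℝ (Fin 3))} (hSm : MeasurableSet S)
    (hS : ∀ x₀ ∈ S, ‖x₀‖ ≤ L ∧ κ * L ^ 2 + ∫ y, probeBump R y * P' (x₀ + y) ≤ P' x₀)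
    (ν : Measure (EuclideanSpace ℝ (Fin 3))) [IsFiniteMeasure ν] {A : ℝ} (hA : 0 < A)
    (hν : ∀ (z : EuclideanSpace ℝ (Fin 3)) (r : ℝ), 0 < r → ν (ball z r) ≤ ENNReal.ofReal (A * r ^ 2)) :
    (ν S).toReal ≤ 4 * A * (12 * (3 : ℝ) ^ (1 - ρ) * cE / (baseBumpMass (EuclideanSpace ℝ (Fin 3)) * κ)) ^ 2 * L ^ (-2 - 2 * ρ) := by
  have hm : 0 < baseBumpMass (EuclideanSpace ℝ (Fin 3)) := baseBumpMass_pos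
  have hL0 : 0 < L := one_pos.trans_le hL
  have h := measure_pressurised_le_of_frostman hprof hcE hE hL hR hRL hκ hSm hS ν hA hν
  have e1 : 12 / baseBumpMass (EuclideanSpace ℝ (Fin 3)) * (cE * (3 * L) ^ (1 - ρ)) / (κ * L ^ 2) =
      12 * (3 : ℝ) ^ (1 - ρ) * cE / (baseBumpMass (EuclideanSpace ℝ (Fin 3)) * κ) * L ^ (-1 - ρ) := by
    rw [Real.mul_rpow (by norm_num) hL0.le,
      show L ^ (-1 - ρ) = L ^ (1 - ρ) / L ^ 2 by
        rw [show (-1 - ρ : ℝ) = (1 - ρ) - 2 by ring, Real.rpow_sub hL0, Real.rpow_two]]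
    field_simp
  have e2 : (12 * (3 : ℝ) ^ (1 - ρ) * cE / (baseBumpMass (EuclideanSpace ℝ (Fin 3)) * κ) * L ^ (-1 - ρ)) ^ 2 =
      (12 * (3 : ℝ) ^ (1 - ρ) * cE / (baseBumpMass (EuclideanSpace ℝ (Fin 3)) * κ)) ^ 2 * L ^ (-2 - 2 * ρ) := by
    rw [mul_pow, show L ^ (-2 - 2 * ρ) = (L ^ (-1 - ρ)) ^ 2 by
      rw [← Real.rpow_natCast (L ^ (-1 - ρ)) 2, ← Real.rpow_mul hL0.le]; norm_num; ring_nf]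
  rw [e1, e2, ← mul_assoc] at h
  exact h

end Summit.NavierStokesRegularity.NavierStokesRegularity.Theorems.PowerGaugeEulerLiouville.PressureParking

end
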